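import Mathlib.Data.Finset.Powerset
import Mathlib.Algebra.BigOperators.Group.Finset.Piecewise
import Mathlib.Order.Lattice.Nat
import Literature.Combinatorics.Enumerative.DiscreteTomography
import HarnessLib

/-!
# Discrete tomography in the cones `x > y > z` and `x ≥ y ≥ z`: sum-marginals, pyramids in a
# cone, layer counts and minimal coordinate sums (Fischer–Ikenmeyer 2020, §5–§6)

Companion of `DiscreteTomography.lean` (marginals `xMarginal`/`yMarginal`/`zMarginal`, coordinate
sums `csum`/`coordSum`, simplices, layers and pyramids of point sets in `ℕ³`, shared by the
NP-hardness proofs for Kronecker and plethysm positivity). Fischer–Ikenmeyer's proof that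
PLETHYSMPOSITIVITY is NP-hard (Comput. Complexity 29 (2020), Thm. 1; barrier fact
`Literature.Barriers.ValiantsHypothesis.FischerIkenmeyer2020_plethysmNPHard`) needs the *cone*
versions of these notions (§5–§6, pp. 9–13 of the held copy `arxiv-2002.00788`), supplied here:

* the **sum-marginal** `S_i(P) = X_i(P) + Y_i(P) + Z_i(P)` (`sumMarginal`; eq. (7): the weight
  of `∧_{(x,y,z) ∈ P} X_x X_y X_z`);
* the **open cone** `C = {x > y > z}`, the **closed cone** `C̄ = {x ≥ y ≥ z}` (`IsInOpenCone`,
  `IsInClosedCone`) and **pyramids in a cone** `K` (`IsConePyramid K P`: `P ⊆ K` and `P` downward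
  closed INSIDE `K` for the coordinatewise order `Below`). This is not the tree's
  `Tomography.IsPyramid` (a down-set of all of `ℕ³`): `{(1,1,0), (1,0,0), (0,0,0)}` is a pyramid
  in `C̄` but not a down-set (it misses `(0,1,0)`);
* compositions `λ ∈ ℕ^{[0,r]}` as lists read as finitely supported functions (`listFn λ i = λ_i`,
  `0` beyond the list) and their coordinate sum `B(λ) = Σ i·λ_i` (`coordSumList`; for
  `λ = S(P)` it equals the tree's `coordSum P = Σ_{p ∈ P} (x+y+z) = B(P)`);
* the box `[0, L)³` (`box`), the layer counts `ξ̄(i)` / `ξ(i)` = number of points of `C̄` / `C`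
  with `x + y + z = i`, the ranks `ῑ(n) = min {ι : Σ_{i ≤ ι} ξ̄(i) ≥ n}`, `ι(n)` and the minimal
  coordinate sums `β̄(n) = Σ_{i=1}^{n} ῑ(i)`, `β(n)` (`xiBar`, `xi`, `iotaBar`, `iota`, `betaBar`,
  `beta`; §5, before Lemma 2), and the cone simplices `{q ∈ K : x + y + z < r}`
  (`conePointsBelow K r`, FI's complete pyramids `P̄_{r-1}` / `P_{r-1}`; `= (simplex r).filter K`);
* the finite sets of Def. 1: `pointSets K λ` / `pyramids K λ` = the point sets / pyramids in `K`
  with sum-marginal `λ` (`ā_λ(n,3) = #pointSets C λᵀ`, `a̲_λ(n,3) = #pyramids C λᵀ`,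
  `b̄_λ(n,3) = #pointSets C̄ λ`, `b̲_λ(n,3) = #pyramids C̄ λ`), with the completeness lemma
  `mem_pointSets_iff` (every point set with sum-marginal `λ` lies in the box `[0, |λ|)³`);
* the promises of Problem 10: `|λ| = 3n ∧ B(λ) = β̄(n)`, resp. `= β(n)` (`SymPromise`,
  `SkewSymPromise`).

Only definitions and their unfolding / finiteness API are here; Lemmas 2, 3, 6 and Prop. 2 are
proved in `DiscreteTomographyConePyramids.lean` and `DiscreteTomographyConeSums.lean`, and the
decision problems (SYMMETRIC-2D-X-RAY, …) live in
`Literature/Computability/Complexity/PlethysmTomography.lean`.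

## References

* [FischerIkenmeyer2020] N. Fischer, C. Ikenmeyer, *The computational complexity of plethysm
  coefficients*, Comput. Complexity 29 (2020) 8, arXiv:2002.00788 (held), §5 (eq. (7), Def. 1,
  Thm. 4, Lemma 2, Prop. 2), §6 (Problems 7, 10; Lemmas 3, 6, 7).
-/

namespace Literature.Combinatorics.Enumerative

namespace Tomography

open Finset

/-! ### Sum-marginals, cones, pyramids in a cone -/

/-- The sum-marginal `S_i(P) = Σ_{(x,y,z) ∈ P} (δ_{x,i} + δ_{y,i} + δ_{z,i}) = X_i + Y_i + Z_i`.
[cite: FischerIkenmeyer2020, §5 eq. (7) and §6 ("S(P) = X(P)+Y(P)+Z(P)")] -/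
def sumMarginal (P : Finset Point3) (i : ℕ) : ℕ := xMarginal P i + yMarginal P i + zMarginal P i

/-- The open cone `C = {(x, y, z) : x > y > z}`. [cite: FischerIkenmeyer2020, §5] -/
def IsInOpenCone (p : Point3) : Prop := p.2.1 < p.1 ∧ p.2.2 < p.2.1

/-- The closed cone `C̄ = {(x, y, z) : x ≥ y ≥ z}`. [cite: FischerIkenmeyer2020, §5] -/
def IsInClosedCone (p : Point3) : Prop := p.2.1 ≤ p.1 ∧ p.2.2 ≤ p.2.1

/-- Membership in the open cone is decidable (two comparisons). [folklore] -/
instance : DecidablePred IsInOpenCone := fun _ => inferInstanceAs (Decidable (_ ∧ _))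

/-- Membership in the closed cone is decidable (two comparisons). [folklore] -/
instance : DecidablePred IsInClosedCone := fun _ => inferInstanceAs (Decidable (_ ∧ _))

/-- The open cone lies in the closed cone. [folklore] -/
theorem IsInOpenCone.isInClosedCone {p : Point3} (h : IsInOpenCone p) : IsInClosedCone p :=
  ⟨h.1.le, h.2.le⟩

/-- The coordinatewise order `(x', y', z') ≤ (x, y, z)`. [cite: FischerIkenmeyer2020, §5 (pyramids)] -/
def Below (q p : Point3) : Prop := q.1 ≤ p.1 ∧ q.2.1 ≤ p.2.1 ∧ q.2.2 ≤ p.2.2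

/-- The coordinatewise order is decidable. [folklore] -/
instance : DecidableRel Below := fun _ _ => inferInstanceAs (Decidable (_ ∧ _ ∧ _))

/-- The finite set of points below `p`. [folklore] -/
def belowSet (p : Point3) : Finset Point3 :=
  range (p.1 + 1) ×ˢ range (p.2.1 + 1) ×ˢ range (p.2.2 + 1)

/-- `belowSet p` lists exactly the points below `p`. [folklore] -/
@[simp] theorem mem_belowSet {p q : Point3} : q ∈ belowSet p ↔ Below q p := by
  simp only [belowSet, Below, mem_product, mem_range]
  omega

/-- `P` is a *pyramid in `K`* (`K` = the open or the closed cone): `P ⊆ K` and `P` is downward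
closed in `K` for the coordinatewise order ("for all `(x,y,z) ∈ P` and all `(x',y',z') ∈ K` with
`x' ≤ x`, `y' ≤ y`, `z' ≤ z` we have `(x',y',z') ∈ P`").
[cite: FischerIkenmeyer2020, §5 (pyramid in the open / closed cone)] -/
def IsConePyramid (K : Point3 → Prop) (P : Finset Point3) : Prop :=
  (∀ p ∈ P, K p) ∧ ∀ p ∈ P, ∀ q, K q → Below q p → q ∈ P

/-- `IsConePyramid` with the inner quantifier bounded by `belowSet` (for decidability). [folklore] -/
theorem isConePyramid_iff_bounded (K : Point3 → Prop) (P : Finset Point3) :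
    IsConePyramid K P ↔ (∀ p ∈ P, K p) ∧ ∀ p ∈ P, ∀ q ∈ belowSet p, K q → q ∈ P := by
  refine and_congr_right fun _ => forall₂_congr fun p _ => ?_
  exact ⟨fun h q hq hK => h q hK (mem_belowSet.1 hq), fun h q hK hb => h q (mem_belowSet.2 hb) hK⟩

/-- Being a pyramid in a decidable region is decidable (bounded form). [folklore] -/
instance (K : Point3 → Prop) [DecidablePred K] (P : Finset Point3) :
    Decidable (IsConePyramid K P) :=
  decidable_of_iff _ (isConePyramid_iff_bounded K P).symm

/-! ### Compositions as functions; coordinate sums of compositions -/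

/-- A composition `λ = [λ_0, …, λ_r] ∈ ℕ^{[0,r]}` as a finitely supported function (`0` beyond
`r`; "treated as finite by omitting trailing zeros"). [cite: FischerIkenmeyer2020, §2 and §6] -/
def listFn (l : List ℕ) (i : ℕ) : ℕ := l.getD i 0

/-- The coordinate sum `B(λ) = Σ_{i=0}^{r} i · λ_i` of a composition. [cite: FischerIkenmeyer2020, §5 (before Lemma 2)] -/
def coordSumList (l : List ℕ) : ℕ := ∑ i ∈ range l.length, i * listFn l i

/-- `listFn` is `List.getD … 0` (unfolding, to interface with statements written with `getD`).
[folklore] -/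
theorem listFn_eq_getD (l : List ℕ) (i : ℕ) : listFn l i = l.getD i 0 := rfl

/-- `listFn` inside the list. [folklore] -/
theorem listFn_of_lt {l : List ℕ} {i : ℕ} (h : i < l.length) : listFn l i = l[i] := by
  simp [listFn, List.getElem?_eq_getElem h]

/-- `listFn` vanishes beyond the list. [folklore] -/
theorem listFn_of_le {l : List ℕ} {i : ℕ} (h : l.length ≤ i) : listFn l i = 0 := by
  simp [listFn, List.getElem?_eq_none h]

/-! ### Boxes, layer counts, ranks, minimal coordinate sums, cone simplices -/

/-- The finite box `[0, L)³` (every point set with marginals supported below `L` lies in it).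
[folklore] -/
def box (L : ℕ) : Finset Point3 := range L ×ˢ range L ×ˢ range L

/-- Membership in the box. [folklore] -/
@[simp] theorem mem_box {L : ℕ} {p : Point3} : p ∈ box L ↔ p.1 < L ∧ p.2.1 < L ∧ p.2.2 < L := by
  simp [box, mem_product]

/-- `ξ̄(i)`: the number of points of the closed cone with coordinate sum `i` (partitions of `i`
into at most three parts, OEIS A001399). [cite: FischerIkenmeyer2020, §5 (before Lemma 2)] -/
def xiBar (i : ℕ) : ℕ := ((box (i + 1)).filter fun p => IsInClosedCone p ∧ csum p = i).card

/-- `ξ(i)`: the number of points of the open cone with coordinate sum `i` (OEIS A069905).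
[cite: FischerIkenmeyer2020, §5 (before Lemma 2)] -/
def xi (i : ℕ) : ℕ := ((box (i + 1)).filter fun p => IsInOpenCone p ∧ csum p = i).card

/-- `ῑ(n) = min {ι : Σ_{i=0}^{ι} ξ̄(i) ≥ n}` (the set is nonempty: `ξ̄(i) ≥ 1`).
[cite: FischerIkenmeyer2020, §5 (before Lemma 2)] -/
noncomputable def iotaBar (n : ℕ) : ℕ := sInf {ι | n ≤ ∑ i ∈ range (ι + 1), xiBar i}

/-- `ι(n) = min {ι : Σ_{i=0}^{ι} ξ(i) ≥ n}` (nonempty: `ξ(i) ≥ 1` for `i ≥ 3`).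
[cite: FischerIkenmeyer2020, §5 (before Lemma 2)] -/
noncomputable def iota (n : ℕ) : ℕ := sInf {ι | n ≤ ∑ i ∈ range (ι + 1), xi i}

/-- `β̄(n) = Σ_{i=1}^{n} ῑ(i)`, the least coordinate sum of an `n`-point set in the closed cone
(Lemma 2). [cite: FischerIkenmeyer2020, §5 (before Lemma 2)] -/
noncomputable def betaBar (n : ℕ) : ℕ := ∑ i ∈ Icc 1 n, iotaBar i

/-- `β(n) = Σ_{i=1}^{n} ι(i)`, the least coordinate sum of an `n`-point set in the open cone
(Lemma 2). [cite: FischerIkenmeyer2020, §5 (before Lemma 2)] -/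
noncomputable def beta (n : ℕ) : ℕ := ∑ i ∈ Icc 1 n, iota i

/-- The points of the cone `K` with coordinate sum `< r`: FI's complete pyramid `P̄_{r-1}`
(closed cone), resp. `P_{r-1}` (open cone); empty for `r = 0`. It is the part of the tree's
`simplex r` in `K` (`conePointsBelow_eq_filter_simplex`). [cite: FischerIkenmeyer2020, §6 (before Lemma 6)] -/
def conePointsBelow (K : Point3 → Prop) [DecidablePred K] (r : ℕ) : Finset Point3 :=
  (box r).filter fun q => K q ∧ csum q < r

/-! ### Def. 1: the point sets and pyramids with a given sum-marginal -/

/-- The point sets in `K` with sum-marginal `λ`, as a finset: all of them lie in the box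
`[0, |λ|)³` with `|λ|` the length of the list (`mem_pointSets_iff`).
[cite: FischerIkenmeyer2020, §5 (Def. 1)] -/
def pointSets (K : Point3 → Prop) [DecidablePred K] (l : List ℕ) : Finset (Finset Point3) :=
  (box l.length).powerset.filter fun P =>
    (∀ p ∈ P, K p) ∧ ∀ i ∈ range l.length, sumMarginal P i = listFn l i

/-- The pyramids in `K` with sum-marginal `λ`. [cite: FischerIkenmeyer2020, §5 (Def. 1)] -/
def pyramids (K : Point3 → Prop) [DecidablePred K] (l : List ℕ) : Finset (Finset Point3) :=
  (pointSets K l).filter fun P => IsConePyramid K P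

/-! ### Multiplicities of a value among the coordinates -/

/-- `m_i(p)`: the number of coordinates of `p` equal to `i` (so `S_i(P) = Σ_{p ∈ P} m_i(p)`).
[cite: FischerIkenmeyer2020, §5 eq. (7)] -/
def mult (i : ℕ) (p : Point3) : ℕ :=
  (if p.1 = i then 1 else 0) + (if p.2.1 = i then 1 else 0) + (if p.2.2 = i then 1 else 0)

/-- `S_i(P) = Σ_{p ∈ P} m_i(p)` (eq. (7) of the source). [cite: FischerIkenmeyer2020, §5 eq. (7)] -/
theorem sumMarginal_eq_sum_mult (P : Finset Point3) (i : ℕ) :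
    sumMarginal P i = ∑ p ∈ P, mult i p := by
  simp only [sumMarginal, xMarginal, yMarginal, zMarginal, mult, Finset.card_filter,
    Finset.sum_add_distrib]

/-! ### The promises of Problem 10 -/

/-- The promise of **PROMISE-SYMMETRIC-3D-X-RAY**: `|λ| = 3n` and `B(λ) = β̄(n)`.
[cite: FischerIkenmeyer2020, §6 (Problem 10)] -/
def SymPromise (l : List ℕ) : Prop := ∃ n : ℕ, l.sum = 3 * n ∧ coordSumList l = betaBar n

/-- The promise of **PROMISE-SKEW-SYMMETRIC-3D-X-RAY**: `|λ| = 3n` and `B(λ) = β(n)`.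
[cite: FischerIkenmeyer2020, §6 (Problem 10)] -/
def SkewSymPromise (l : List ℕ) : Prop := ∃ n : ℕ, l.sum = 3 * n ∧ coordSumList l = beta n

/-! ### Basic API -/

/-- A point of `P` with `x`-coordinate `i` makes `S_i(P)` positive. [folklore] -/
theorem sumMarginal_pos_of_fst {P : Finset Point3} {p : Point3} (hp : p ∈ P) :
    0 < sumMarginal P p.1 := by
  have : 0 < xMarginal P p.1 := card_pos.2 ⟨p, mem_filter.2 ⟨hp, rfl⟩⟩
  unfold sumMarginal; omega

/-- A point of `P` with `y`-coordinate `i` makes `S_i(P)` positive. [folklore] -/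
theorem sumMarginal_pos_of_snd {P : Finset Point3} {p : Point3} (hp : p ∈ P) :
    0 < sumMarginal P p.2.1 := by
  have : 0 < yMarginal P p.2.1 := card_pos.2 ⟨p, mem_filter.2 ⟨hp, rfl⟩⟩
  unfold sumMarginal; omega

/-- A point of `P` with `z`-coordinate `i` makes `S_i(P)` positive. [folklore] -/
theorem sumMarginal_pos_of_thd {P : Finset Point3} {p : Point3} (hp : p ∈ P) :
    0 < sumMarginal P p.2.2 := by
  have : 0 < zMarginal P p.2.2 := card_pos.2 ⟨p, mem_filter.2 ⟨hp, rfl⟩⟩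
  unfold sumMarginal; omega

/-- The sum-marginal is additive over disjoint unions. [folklore] -/
theorem sumMarginal_union {A B : Finset Point3} (h : Disjoint A B) :
    sumMarginal (A ∪ B) = sumMarginal A + sumMarginal B := by
  funext i
  simp only [sumMarginal, xMarginal, yMarginal, zMarginal, Finset.filter_union, Pi.add_apply,
    Finset.card_union_of_disjoint (Finset.disjoint_filter_filter h)]
  ring

/-- The sum-marginal is monotone. [folklore] -/
theorem sumMarginal_mono {A B : Finset Point3} (h : A ⊆ B) (i : ℕ) :
    sumMarginal A i ≤ sumMarginal B i := by
  simp only [sumMarginal, xMarginal, yMarginal, zMarginal]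
  gcongr

/-- A point set with sum-marginal `λ` lies in the box `[0, |λ|)³`. [folklore] -/
theorem subset_box_of_sumMarginal_eq {P : Finset Point3} {l : List ℕ}
    (h : sumMarginal P = listFn l) : P ⊆ box l.length := by
  intro p hp
  have h1 := sumMarginal_pos_of_fst hp
  have h2 := sumMarginal_pos_of_snd hp
  have h3 := sumMarginal_pos_of_thd hp
  rw [h] at h1 h2 h3
  refine mem_box.2 ⟨?_, ?_, ?_⟩ <;> by_contra hc <;> push Not at hc
  · exact absurd (listFn_of_le hc) h1.ne'
  · exact absurd (listFn_of_le hc) h2.ne'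
  · exact absurd (listFn_of_le hc) h3.ne'

/-- The marginals of a point set inside the box `[0, L)³` vanish from `L` on. [folklore] -/
theorem sumMarginal_eq_zero_of_subset_box {P : Finset Point3} {L i : ℕ} (hP : P ⊆ box L)
    (hi : L ≤ i) : sumMarginal P i = 0 := by
  have hx : xMarginal P i = 0 := card_eq_zero.2 (filter_eq_empty_iff.2
    fun p hp h => by have := (mem_box.1 (hP hp)).1; omega)
  have hy : yMarginal P i = 0 := card_eq_zero.2 (filter_eq_empty_iff.2
    fun p hp h => by have := (mem_box.1 (hP hp)).2.1; omega)
  have hz : zMarginal P i = 0 := card_eq_zero.2 (filter_eq_empty_iff.2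
    fun p hp h => by have := (mem_box.1 (hP hp)).2.2; omega)
  simp [sumMarginal, hx, hy, hz]

/-- **`pointSets` is complete**: a finite point set is listed in `pointSets K λ` iff it lies in `K`
and has sum-marginal `λ`. [cite: FischerIkenmeyer2020, §5 (Def. 1)] -/
theorem mem_pointSets_iff {K : Point3 → Prop} [DecidablePred K] {l : List ℕ} {P : Finset Point3} :
    P ∈ pointSets K l ↔ (∀ p ∈ P, K p) ∧ sumMarginal P = listFn l := by
  rw [pointSets, mem_filter, mem_powerset]
  constructor
  · rintro ⟨hP, hK, hS⟩
    refine ⟨hK, funext fun i => ?_⟩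
    by_cases hi : i < l.length
    · exact hS i (mem_range.2 hi)
    · push Not at hi
      rw [sumMarginal_eq_zero_of_subset_box hP hi, listFn_of_le hi]
  · rintro ⟨hK, hS⟩
    exact ⟨subset_box_of_sumMarginal_eq hS, hK, fun i _ => by rw [hS]⟩

/-- Membership in `pyramids`. [cite: FischerIkenmeyer2020, §5 (Def. 1)] -/
theorem mem_pyramids_iff {K : Point3 → Prop} [DecidablePred K] {l : List ℕ} {P : Finset Point3} :
    P ∈ pyramids K l ↔ IsConePyramid K P ∧ sumMarginal P = listFn l := by
  rw [pyramids, mem_filter, mem_pointSets_iff]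
  exact ⟨fun h => ⟨h.2, h.1.2⟩, fun h => ⟨⟨h.1.1, h.2⟩, h.1⟩⟩

/-- `pointSets K λ` depends on `λ` only through the function `listFn λ` (trailing zeros of the
list are immaterial). [folklore] -/
theorem pointSets_congr {K : Point3 → Prop} [DecidablePred K] {l l' : List ℕ}
    (h : listFn l = listFn l') : pointSets K l = pointSets K l' := by
  ext P
  rw [mem_pointSets_iff, mem_pointSets_iff, h]

/-- `pyramids K λ` depends on `λ` only through `listFn λ`. [folklore] -/
theorem pyramids_congr {K : Point3 → Prop} [DecidablePred K] {l l' : List ℕ}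
    (h : listFn l = listFn l') : pyramids K l = pyramids K l' := by
  rw [pyramids, pyramids, pointSets_congr h]

/-- The set defining `ῑ(n)` is nonempty: `Σ_{i ≤ n} ξ̄(i) ≥ n` because `(i, 0, 0) ∈ C̄` gives
`ξ̄(i) ≥ 1`. [folklore] -/
theorem le_sum_xiBar (n : ℕ) : n ≤ ∑ i ∈ range (n + 1), xiBar i := by
  have h1 : ∀ i, 1 ≤ xiBar i := fun i =>
    card_pos.2 ⟨(i, 0, 0), mem_filter.2 ⟨mem_box.2 ⟨by simp, by simp, by simp⟩,
      ⟨by simp [IsInClosedCone], by simp [csum]⟩⟩⟩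
  calc n ≤ n + 1 := Nat.le_succ n
    _ = ∑ _i ∈ range (n + 1), 1 := by simp
    _ ≤ ∑ i ∈ range (n + 1), xiBar i := sum_le_sum fun i _ => h1 i

/-- The set defining `ι(n)` is nonempty: `Σ_{i < n+3} ξ(i) ≥ n` because `(i+2, 1, 0) ∈ C` gives
`ξ(i + 3) ≥ 1`. [folklore] -/
theorem le_sum_xi (n : ℕ) : n ≤ ∑ i ∈ range (3 + n), xi i := by
  have h1 : ∀ i, 1 ≤ xi (3 + i) := fun i =>
    card_pos.2 ⟨(i + 2, 1, 0), mem_filter.2 ⟨mem_box.2 ⟨by simp; omega, by simp, by simp⟩,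
      ⟨by simp [IsInOpenCone], by simp [csum]; omega⟩⟩⟩
  calc n = ∑ _i ∈ range n, 1 := by simp
    _ ≤ ∑ i ∈ range n, xi (3 + i) := sum_le_sum fun i _ => h1 i
    _ ≤ ∑ i ∈ range 3, xi i + ∑ i ∈ range n, xi (3 + i) := Nat.le_add_left _ _
    _ = ∑ i ∈ range (3 + n), xi i := (sum_range_add xi 3 n).symm

/-- `ῑ(n)` attains the defining inequality. [cite: FischerIkenmeyer2020, §5 (before Lemma 2)] -/
theorem le_sum_xiBar_iotaBar (n : ℕ) : n ≤ ∑ i ∈ range (iotaBar n + 1), xiBar i :=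
  Nat.sInf_mem (s := {ι | n ≤ ∑ i ∈ range (ι + 1), xiBar i}) ⟨n, le_sum_xiBar n⟩

/-- `ι(n)` attains the defining inequality. [cite: FischerIkenmeyer2020, §5 (before Lemma 2)] -/
theorem le_sum_xi_iota (n : ℕ) : n ≤ ∑ i ∈ range (iota n + 1), xi i :=
  Nat.sInf_mem (s := {ι | n ≤ ∑ i ∈ range (ι + 1), xi i})
    ⟨2 + n, by
      change n ≤ ∑ i ∈ range (2 + n + 1), xi i
      rw [show 2 + n + 1 = 3 + n by omega]; exact le_sum_xi n⟩

/-- Minimality of `ῑ(n)`. [cite: FischerIkenmeyer2020, §5 (before Lemma 2)] -/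
theorem iotaBar_le {n ι : ℕ} (h : n ≤ ∑ i ∈ range (ι + 1), xiBar i) : iotaBar n ≤ ι :=
  Nat.sInf_le h

/-- Minimality of `ι(n)`. [cite: FischerIkenmeyer2020, §5 (before Lemma 2)] -/
theorem iota_le {n ι : ℕ} (h : n ≤ ∑ i ∈ range (ι + 1), xi i) : iota n ≤ ι :=
  Nat.sInf_le h

/-- Membership in `conePointsBelow`. [folklore] -/
theorem mem_conePointsBelow (K : Point3 → Prop) [DecidablePred K] {r : ℕ} {q : Point3} :
    q ∈ conePointsBelow K r ↔ K q ∧ csum q < r := by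
  rw [conePointsBelow, mem_filter, and_iff_right_iff_imp]
  rintro ⟨-, h⟩
  simp only [mem_box, csum] at h ⊢
  omega

/-- `conePointsBelow K r` lies in the box `[0, r)³`. [folklore] -/
theorem conePointsBelow_subset_box (K : Point3 → Prop) [DecidablePred K] (r : ℕ) :
    conePointsBelow K r ⊆ box r :=
  filter_subset _ _

/-- `conePointsBelow K r` is the part of the tree's discrete simplex `simplex r` lying in `K`.
[cite: FischerIkenmeyer2020, §6 (complete pyramids) and §7 (Q_r)] -/
theorem conePointsBelow_eq_filter_simplex (K : Point3 → Prop) [DecidablePred K] (r : ℕ) :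
    conePointsBelow K r = (simplex r).filter fun q => K q := by
  ext q
  rw [mem_conePointsBelow, mem_filter, mem_simplex, and_comm]

end Tomography

end Literature.Combinatorics.Enumerative
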